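import Literature.Topology.FourManifolds.SphereSurgeryMiddleHomology
import HarnessLib

/-!
# Surgery on spheres of codimension two and more: simple connectivity from the complement

Topic `Literature/Topology/FourManifolds`; a proof file (no definitions, no named facts), companion
of `SphereSurgeryMiddleHomology.lean` §5.  There, `FramedSphereFamily.simplyConnectedSpace_of_surgery_family`
shows that a simultaneous surgery `χ(X, φ₁, …, φᵣ)` along disjoint framed `k`-spheres with normal
fibre `ℝˡ⁺¹` keeps a simply connected `X` simply connected when `k ≥ 2` **and `l ≥ 2`**: for
`l ≥ 2` the cores have codimension `≥ 3`, so `X ∖ ⋃ Sᵢ` is simply connected as soon as `X` is.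
For surgery on **2-spheres in a 4-manifold** (`k = 2`, `l = 1` — the surgeries of the cork
decomposition theorem, Matveyev 1996, Proof of Theorem, step 3: *"Surgery of `V₃` along collections
of embedded spheres `{Sᵢ}` and `{Pᵢ}` gives two contractible sub-manifolds `W₁` and `W₂`"*, and of
Kirby 1996 §1: *"`S₀ × B²` has been removed … thus removing the 2-handle"*) the complement
`X ∖ ⋃ Sᵢ` acquires the meridians of the spheres and need not be simply connected; what survives of
the argument is its second half, which this file isolates:

* `FramedSphereFamily.simplyConnectedSpace_of_surgery_family_of_compl` — **if `X ∖ ⋃ Sᵢ` is simply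
  connected then so is the surgered space `P`**, for `k ≥ 2` and `l ≥ 1` (relational gluing form
  `P = jA(X ∖ ⋃ Sᵢ) ∪ jB(ι × OD^{k+1} × Sˡ)`): `P` is path connected
  (`pathConnectedSpace_of_surgery_family`), `P ∖ ⋃ S'ᵢ = jA(X ∖ ⋃ Sᵢ)` for the cocores
  `S'ᵢ = jB(i, 0, Sˡ)` (`compl_iUnion_coCore_eq_range`), and the cocores are circles (or spheres
  `Sˡ`) with product neighbourhoods `Sˡ × ℝᵏ⁺¹` of simply connected punctured fibre (`k + 1 ≥ 3`),
  so putting them back does not change simple connectivity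
  (`simplyConnectedSpace_compl_iUnion_core_iff`; Kosinski 1993, X.2, proof of Thm. 2.2).  In the
  words of Milnor 1965, §3 p. 21 for `λ = 3`, `n = 4`: passing the level of an index-`3` critical
  point replaces `S² × OD²` by `OD³ × S¹`, and `π₁(OD³ × S¹) = ℤ` is carried by the meridian
  `S¹`, which already lives in the complement.
* `FramedSphereFamily.simplyConnectedSpace_surgered_family_of_compl` — the same for the surgered
  manifold `ν.Surgered hkl` of the tree (`SphereFamilySurgeryExistence.lean`).
* `FramedSphereFamily.simplyConnectedSpace_surgered_two_two_of_compl` — the four-dimensional case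
  spelled out: for a finite disjoint framed family of 2-spheres with 2-dimensional normal fibre in a
  smooth 4-manifold `X` (with boundary), if `X ∖ ⋃ Sᵢ` is simply connected then `χ(X, ν)` is simply
  connected.

This is the `π₁` half of step 3 of Matveyev's proof read through the complement (the other half —
that the meridians die in `V₃ ∖ ⋃ Sᵢ` because of the geometrically dual immersed spheres — is the
four-dimensional input and is not treated here); the homological half is Kervaire–Milnor's Lemma 7.1
(`FramedSphereFamily.isZero_singularHomology_of_surgery_middle` / `_of_le`, same companion file).

## References

* A. Kosinski, *Differential Manifolds* (1993), Ch. X §2, Thm. (2.2) and its proof (p. 201).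
  [Kosinski1993]
* J. Milnor, *Lectures on the h-cobordism theorem* (1965), Def. 3.11 (PDF p. 17), §3 p. 21.
  [MilnorHCobordism1965]
* R. Matveyev, *A decomposition of smooth simply-connected h-cobordant 4-manifolds*, J. Differential
  Geom. 44 (1996); arXiv:dg-ga/9505001, Proof of Theorem, step 3 (p. 2). [Matveyev1996]
* R. Kirby, *Akbulut's corks and h-cobordisms of smooth, simply connected 4-manifolds*, Turkish J.
  Math. 20 (1996); arXiv:math/9712231, §1. [KirbyCorks1996]
-/

noncomputable section

open scoped Manifold ContDiff Topology ContinuousMap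
open Set Function Metric Topology
open Literature.AlgebraicTopology.SingularHomology
open Literature.AlgebraicTopology.FundamentalGroup

namespace Literature.Topology.FourManifolds

/-! ### §1 The relational gluing form -/

section PiOne

variable {EX HX : Type*} [NormedAddCommGroup EX] [NormedSpace ℝ EX] [TopologicalSpace HX]
  {IX : ModelWithCorners ℝ EX HX} {X : Type} [TopologicalSpace X] [ChartedSpace HX X] [T2Space X]
  {ι : Type} [Finite ι] {k l : ℕ} {ν : FramedSphereFamily IX X ι k (l + 1)}
  {P : Type} [TopologicalSpace P] [T2Space P]
  {jA : ↥(ν.coresᶜ) → P} {jB : ↥(ballTimesSphere ι k l) → P}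
  (hA : IsOpenEmbedding jA) (hB : IsOpenEmbedding jB) (hcov : range jA ∪ range jB = univ)
  (hrel : ∀ a b, jA a = jB b ↔ sphereFamilySurgeryRel ν a b)

namespace FramedSphereFamily

include hA hB hcov hrel in
/-- **A family surgery of index `k + 1 ≥ 3` with cospheres `Sˡ`, `l ≥ 1`, on a space whose sphere
complement `X ∖ ⋃ Sᵢ` is simply connected gives a simply connected space** (Kosinski 1993, X.2,
proof of (2.2), second half: `P` is obtained from `P ∖ ⋃ S'ᵢ = jA(X ∖ ⋃ Sᵢ)` by putting back the
cocores `S'ᵢ ≅ Sˡ`, which have product neighbourhoods `Sˡ × ℝᵏ⁺¹` with simply connected punctured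
fibre).  For `k = 2`, `l = 1` this is surgery on 2-spheres in a 4-manifold, where the hypothesis on
the complement is genuinely stronger than simple connectivity of `X`.
[cite: Kosinski1993, Ch. X §2, Thm. 2.2 (proof)] [cite: MilnorHCobordism1965, §3 p. 21] -/
theorem simplyConnectedSpace_of_surgery_family_of_compl [SimplyConnectedSpace ↥(ν.coresᶜ)]
    (hk : 2 ≤ k) (hl : 1 ≤ l) : SimplyConnectedSpace P := by
  haveI := Fintype.ofFinite ι
  haveI : PathConnectedSpace P := pathConnectedSpace_of_surgery_family hA hB hcov hrel hl
  obtain ⟨ψ, hψ, hdisj, hψ0⟩ := exists_coTubes (ι := ι) (k := k) (l := l) hB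
  -- `range jA ≅ X ∖ cores` is simply connected
  have hA' : SimplyConnectedSpace ↥(range jA) :=
    (hA.isEmbedding.toHomeomorph (X := ↥(ν.coresᶜ))).toHomotopyEquiv.simplyConnectedSpace_iff.1
      inferInstance
  -- and it is the complement of the cocores
  rw [← compl_iUnion_coCore_eq_range hcov hrel hψ0] at hA'
  haveI := pathConnectedSpace_sphere (n := l) (by omega)
  haveI := simplyConnectedSpace_compl_zero (l := k) hk
  exact (simplyConnectedSpace_compl_iUnion_core_iff (W := P)
    (Z := (Metric.sphere (0 : EuclideanSpace ℝ (Fin (l + 1))) 1)) (E := EuclideanSpace ℝ (Fin (k + 1)))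
    ψ hψ hdisj).1 hA'

end FramedSphereFamily

end PiOne

/-! ### §2 The surgered manifold `χ(X, φ₁, …, φᵣ)` of the tree -/

section Surgered

variable {n k l : ℕ} {X : Type} [TopologicalSpace X] [ChartedSpace (EuclideanHalfSpace (n + 1)) X]
  [T2Space X] [IsManifold (𝓡∂ (n + 1)) ∞ X] {ι : Type} [Finite ι] [Nonempty ι]

namespace FramedSphereFamily

/-- **A finite family surgery of index `k + 1 ≥ 3` with cospheres `Sˡ`, `l ≥ 1`, of a manifold
whose sphere complement is simply connected, is simply connected.**
[cite: Kosinski1993, Ch. X §2, Thm. 2.2 (proof)] [cite: MilnorHCobordism1965, Def. 3.11, §3 p. 21] -/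
theorem simplyConnectedSpace_surgered_family_of_compl
    (ν : FramedSphereFamily (𝓡∂ (n + 1)) X ι k (l + 1)) (hkl : k + l = n)
    [SimplyConnectedSpace ↥(ν.coresᶜ)] (hk : 2 ≤ k) (hl : 1 ≤ l) :
    SimplyConnectedSpace (ν.Surgered hkl) := by
  obtain ⟨hA, hB, hcov, hrel⟩ := ν.surgered_gluing_family hkl
  exact simplyConnectedSpace_of_surgery_family_of_compl hA hB hcov hrel hk hl

/-- **Surgery on 2-spheres in a 4-manifold, `π₁` from the complement** (the case `k = 2`, `l = 1`:
Matveyev 1996, Proof of Theorem, step 3; Kirby 1996, §1): for a finite disjoint framed family `ν` of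
2-spheres with 2-dimensional normal fibre in a smooth 4-manifold `X` with boundary, if `X ∖ ⋃ Sᵢ`
is simply connected then the surgered manifold `χ(X, ν)` — each `Sᵢ × OD²` replaced by
`OD³ × S¹` — is simply connected.
[cite: Matveyev1996, Proof of Theorem, step 3 (arXiv p. 2)] [cite: Kosinski1993, Ch. X §2, Thm. 2.2 (proof)] -/
theorem simplyConnectedSpace_surgered_two_two_of_compl {X : Type} [TopologicalSpace X]
    [ChartedSpace (EuclideanHalfSpace (3 + 1)) X] [T2Space X] [IsManifold (𝓡∂ (3 + 1)) ∞ X]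
    (ν : FramedSphereFamily (𝓡∂ (3 + 1)) X ι 2 (1 + 1)) [SimplyConnectedSpace ↥(ν.coresᶜ)] :
    SimplyConnectedSpace (ν.Surgered (show 2 + 1 = 3 from rfl)) :=
  ν.simplyConnectedSpace_surgered_family_of_compl rfl le_rfl le_rfl

end FramedSphereFamily

end Surgered

end Literature.Topology.FourManifolds

end
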